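import Mathlib
import Summits.Ventures.HodgeRepro2.T5RamificationIndexGlobal
import Summits.Ventures.HodgeRepro2.T5AdicCompletionResidueField
import Summits.Ventures.HodgeRepro2.T5RecordSatakeDiscriminant

/-!
# CLAUSE (u2) IN KERNEL: AT AN UNRAMIFIED PLACE THE CONDUCTOR OF `ψ ∘ Tr` IS THE CONDUCTOR OF `ψ`

Tier-5 support N3 / §G-N4.2 (seat p3, gen 83). §N3.10.3's clause (u2) — «`ψ_v = ψ_p ∘ Tr_{F_v/ℚ_p}` has conductor
`𝒪_v` outside the different» — has two halves. Seat p4's (A6) CONDUCTOR FORMULA on Mathlib's completions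
(`T5AdicCompletionConductor.exists_conductorExp_comp_trace_eq`: for `w ∣ v`, a continuous non-trivial
`ψ : K_v → S¹` and the local different `𝔇(𝒪_w/𝒪_v) = (π^d)`, `n(ψ ∘ Tr) = e · n(ψ) + d`) is the analytic half;
files 320–322 of this seat describe WHERE `e = 1` globally (`v ∤ 𝔇_{F/ℚ}`, `disc F ∉ v`). This file joins them:

* **`map_maximalIdeal_eq_of_ramificationIdx'_eq_one`** — for `e(w/v) = 1` the maximal ideal of `𝒪_v` extends to the
  maximal ideal of `𝒪_w` (p4's `irreducible_algebraMap_iff`); **`formallyUnramified_of_ramificationIdx'_eq_one`**,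
  **`isUnramifiedAt_maximalIdeal_of_ramificationIdx'_eq_one`** — the local extension `𝒪_w/𝒪_v` is unramified
  (Mathlib's `FormallyUnramified.iff_map_maximalIdeal_eq`; the residue extension is separable, the residue
  fields being finite by p4's `T5AdicCompletionResidueField`);
* **`differentIdeal_adicCompletionIntegers_eq_top_of_ramificationIdx'_eq_one`** — THE LOCAL DIFFERENT IS TRIVIAL,
  `d = 0` (Mathlib's `not_dvd_differentIdeal_iff` on the DVR pair); **`ramificationIdx'_span_eq_one`** — the local
  index of the uniformisers is `1`;
* **`conductorExp_comp_trace_eq_of_ramificationIdx'_eq_one`** — `n(ψ ∘ Tr_{L_w/K_v}) = n(ψ)` for every continuous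
  non-trivial `ψ` on `K_v`, at every `w ∣ v` with `e(w/v) = 1`;
* **`ramificationIdx'_eq_one_of_ramificationIdx_int_eq_one`** — the bridge `e(v/p) = 1` over `ℤ` (file 320's
  vocabulary) ⇒ `e(v/v_p) = 1` over `𝓞_ℚ` (the tower `ℤ ⊆ 𝓞_ℚ ⊆ 𝓞_F`);
* **`conductorExp_comp_trace_eq_of_ramificationIdx_int_eq_one`** / **`…_of_discr_notMem`** /
  **`conductorExp_comp_trace_eq_of_discr_notMem_cm`** — CLAUSE (u2): for every number field `F` (for the record:
  `F = K⁺`, `K` any CM field), every place `v` of `F` above the place `v_p` of `ℚ` with `e(v/p) = 1` — in particular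
  every `v` with `disc F ∉ v`, and for `F = K⁺` every `v` with `disc K ∉ v` — and every continuous non-trivial
  `ψ : ℚ_p → S¹`: `n(ψ ∘ Tr_{F_v/ℚ_p}) = n(ψ)`; with the standard `ψ_p` of conductor exponent `0`, `ψ_v` has
  conductor `𝒪_v`.

With this file every clause of §N3.10.3's finiteness argument is a theorem of the tree outside the places dividing
`disc K`. §8(d): uses an L-value-free non-vanishing device: NO.
-/

open IsDedekindDomain IsDedekindDomain.HeightOneSpectrum NumberField IsLocalRing
open Summit.Ventures.HodgeRepro2.T5AdicCompletionConductor Summit.Ventures.HodgeRepro2.T5RamificationIndexGlobal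
  Summit.Ventures.HodgeRepro2.T5AdditiveConductor

namespace Summit.Ventures.HodgeRepro2.T5ConductorUnramifiedPlace

section Local

variable {K L : Type*} [Field K] [NumberField K] [Field L] [NumberField L] [Algebra K L]
variable (v : HeightOneSpectrum (𝓞 K)) (w : HeightOneSpectrum (𝓞 L)) [w.asIdeal.LiesOver v.asIdeal]

/-- **For `e(w/v) = 1` the maximal ideal of `𝒪_v` extends to the maximal ideal of `𝒪_w`**: a uniformiser of `K_v`
stays a uniformiser of `L_w` (p4's `irreducible_algebraMap_iff`). -/
theorem map_maximalIdeal_eq_of_ramificationIdx'_eq_one (he : v.asIdeal.ramificationIdx' w.asIdeal = 1) :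
    (maximalIdeal (v.adicCompletionIntegers K)).map
        (algebraMap (v.adicCompletionIntegers K) (w.adicCompletionIntegers L)) =
      maximalIdeal (w.adicCompletionIntegers L) := by
  obtain ⟨ϖ, hϖ⟩ := exists_irreducible (K := K) v
  have hπ : Irreducible (algebraMap (v.adicCompletionIntegers K) (w.adicCompletionIntegers L) ϖ) :=
    (irreducible_algebraMap_iff v w hϖ).mpr he
  rw [hϖ.maximalIdeal_eq, Ideal.map_span, Set.image_singleton, hπ.maximalIdeal_eq]

/-- **The local extension `𝒪_w/𝒪_v` is formally unramified when `e(w/v) = 1`** (Mathlib's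
`FormallyUnramified.iff_map_maximalIdeal_eq`; the residue fields are finite, hence the residue extension is
separable). -/
theorem formallyUnramified_of_ramificationIdx'_eq_one (he : v.asIdeal.ramificationIdx' w.asIdeal = 1) :
    Algebra.FormallyUnramified (v.adicCompletionIntegers K) (w.adicCompletionIntegers L) :=
  Algebra.FormallyUnramified.iff_map_maximalIdeal_eq.mpr
    ⟨inferInstance, map_maximalIdeal_eq_of_ramificationIdx'_eq_one v w he⟩

/-- **`𝒪_w` is unramified over `𝒪_v` at its maximal ideal** (the localisation at the maximal ideal is formally
unramified over `𝒪_v`). -/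
theorem isUnramifiedAt_maximalIdeal_of_ramificationIdx'_eq_one (he : v.asIdeal.ramificationIdx' w.asIdeal = 1) :
    Algebra.IsUnramifiedAt (v.adicCompletionIntegers K) (maximalIdeal (w.adicCompletionIntegers L)) :=
  haveI := formallyUnramified_of_ramificationIdx'_eq_one v w he
  inferInstance

/-- **THE LOCAL DIFFERENT IS TRIVIAL AT AN UNRAMIFIED PLACE**: `𝔇(𝒪_w/𝒪_v) = 𝒪_w` when `e(w/v) = 1` (Mathlib's
`not_dvd_differentIdeal_iff` on the DVR `𝒪_w`: a proper ideal is divisible by the maximal ideal). -/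
theorem differentIdeal_adicCompletionIntegers_eq_top_of_ramificationIdx'_eq_one
    (he : v.asIdeal.ramificationIdx' w.asIdeal = 1) :
    differentIdeal (v.adicCompletionIntegers K) (w.adicCompletionIntegers L) = ⊤ := by
  haveI := isTorsionFree_adicCompletionIntegers v w
  haveI := finite_adicCompletionIntegers v w
  haveI := isUnramifiedAt_maximalIdeal_of_ramificationIdx'_eq_one v w he
  by_contra hne
  have hle : differentIdeal (v.adicCompletionIntegers K) (w.adicCompletionIntegers L) ≤
      maximalIdeal (w.adicCompletionIntegers L) := le_maximalIdeal hne
  exact (not_dvd_differentIdeal_iff (A := v.adicCompletionIntegers K)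
    (P := maximalIdeal (w.adicCompletionIntegers L))).mpr inferInstance (Ideal.dvd_iff_le.mpr hle)

/-- **The local ramification index of the uniformisers is `1`**: `(ϖ).ramificationIdx' (π) = 1` for irreducible
`ϖ ∈ 𝒪_v`, `π ∈ 𝒪_w` when `e(w/v) = 1` (`(ϖ) 𝒪_w = (π)`, and `(π) ≰ (π)²`). -/
theorem ramificationIdx'_span_eq_one (he : v.asIdeal.ramificationIdx' w.asIdeal = 1)
    {ϖ : v.adicCompletionIntegers K} (hϖ : Irreducible ϖ) {π : w.adicCompletionIntegers L} (hπ : Irreducible π) :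
    (Ideal.span {ϖ}).ramificationIdx' (Ideal.span {π}) = 1 := by
  have hmap : (Ideal.span {ϖ}).map (algebraMap (v.adicCompletionIntegers K) (w.adicCompletionIntegers L)) =
      Ideal.span {π} := by
    rw [← hϖ.maximalIdeal_eq, map_maximalIdeal_eq_of_ramificationIdx'_eq_one v w he, hπ.maximalIdeal_eq]
  apply Ideal.ramificationIdx'_spec
  · rw [hmap, pow_one]
  · rw [hmap]
    intro h
    have hlt : Ideal.span {π} ^ 2 < Ideal.span {π} :=
      Ideal.pow_lt_self _ (by rw [ne_eq, Ideal.span_singleton_eq_bot]; exact hπ.ne_zero)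
        (Ideal.span_singleton_ne_top hπ.not_isUnit) 2 le_rfl
    exact hlt.not_ge h

/-- **CLAUSE (u2), LOCAL FORM: `n(ψ ∘ Tr_{L_w/K_v}) = n(ψ)` at every `w ∣ v` with `e(w/v) = 1`**, for every continuous
non-trivial `ψ : K_v → S¹` (p4's conductor formula `n(ψ ∘ Tr) = e · n(ψ) + d` with `e = 1` and `d = 0`). -/
theorem conductorExp_comp_trace_eq_of_ramificationIdx'_eq_one (he : v.asIdeal.ramificationIdx' w.asIdeal = 1)
    (ψ : AddChar (v.adicCompletion K) Circle) (hψ : Continuous ψ) (hne : ∃ y, ψ y ≠ 1) :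
    conductorExp (ψ.compAddMonoidHom
        (Algebra.trace (v.adicCompletion K) (w.adicCompletion L)).toAddMonoidHom) Valued.v =
      conductorExp ψ Valued.v := by
  obtain ⟨ϖ, π, d, hϖ, hπ, hD, hform⟩ := exists_conductorExp_comp_trace_eq v w ψ hψ hne
  have hd : d = 0 := by
    rw [differentIdeal_adicCompletionIntegers_eq_top_of_ramificationIdx'_eq_one v w he] at hD
    have hu : IsUnit (π ^ d) := Ideal.span_singleton_eq_top.mp hD.symm
    by_contra hd0
    exact hπ.not_isUnit ((isUnit_pow_iff hd0).mp hu)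
  rw [hform, ramificationIdx'_span_eq_one v w he hϖ hπ, hd]
  simp

end Local

section Rational

variable {F : Type*} [Field F] [NumberField F]
variable (vp : HeightOneSpectrum (𝓞 ℚ)) (v : HeightOneSpectrum (𝓞 F)) [hv : v.asIdeal.LiesOver vp.asIdeal]

include hv in
/-- **The bridge from file 320's vocabulary**: `e(v/p) = 1` over `ℤ` gives `e(v/v_p) = 1` over `𝓞_ℚ` (Mathlib's
`ramificationIdx'_eq_ramificationIdx` and the tower `ℤ ⊆ 𝓞_ℚ ⊆ 𝓞_F`: the index over `𝓞_ℚ` divides the index over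
`ℤ`). -/
theorem ramificationIdx'_eq_one_of_ramificationIdx_int_eq_one (h : v.asIdeal.ramificationIdx ℤ = 1) :
    vp.asIdeal.ramificationIdx' v.asIdeal = 1 := by
  rw [Ideal.ramificationIdx'_eq_ramificationIdx vp.asIdeal v.asIdeal vp.ne_bot]
  have hdvd : v.asIdeal.ramificationIdx (𝓞 ℚ) ∣ v.asIdeal.ramificationIdx ℤ :=
    Ideal.ramificationIdx_above_dvd (R := ℤ) vp.asIdeal v.asIdeal
  rw [h] at hdvd
  exact Nat.dvd_one.mp hdvd

include hv in
/-- **CLAUSE (u2) FOR A NUMBER FIELD `F` OVER `ℚ`**: at every place `v` of `F` above the place `v_p` of `ℚ` with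
`e(v/p) = 1`, and for every continuous non-trivial `ψ : ℚ_p → S¹`, `n(ψ ∘ Tr_{F_v/ℚ_p}) = n(ψ)`. -/
theorem conductorExp_comp_trace_eq_of_ramificationIdx_int_eq_one (h : v.asIdeal.ramificationIdx ℤ = 1)
    (ψ : AddChar (vp.adicCompletion ℚ) Circle) (hψ : Continuous ψ) (hne : ∃ y, ψ y ≠ 1) :
    conductorExp (ψ.compAddMonoidHom
        (Algebra.trace (vp.adicCompletion ℚ) (v.adicCompletion F)).toAddMonoidHom) Valued.v =
      conductorExp ψ Valued.v :=
  conductorExp_comp_trace_eq_of_ramificationIdx'_eq_one vp v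
    (ramificationIdx'_eq_one_of_ramificationIdx_int_eq_one vp v h) ψ hψ hne

include hv in
/-- **CLAUSE (u2) OUTSIDE THE DISCRIMINANT**: `n(ψ ∘ Tr_{F_v/ℚ_p}) = n(ψ)` at every place `v` of `F` not containing
`disc F` (file 320's «unramified outside the discriminant»). -/
theorem conductorExp_comp_trace_eq_of_discr_notMem (h : ((discr F : ℤ) : 𝓞 F) ∉ v.asIdeal)
    (ψ : AddChar (vp.adicCompletion ℚ) Circle) (hψ : Continuous ψ) (hne : ∃ y, ψ y ≠ 1) :
    conductorExp (ψ.compAddMonoidHom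
        (Algebra.trace (vp.adicCompletion ℚ) (v.adicCompletion F)).toAddMonoidHom) Valued.v =
      conductorExp ψ Valued.v :=
  conductorExp_comp_trace_eq_of_ramificationIdx_int_eq_one vp v
    (T5RecordDifferentTower.ramificationIdx_int_eq_one_of_discr_notMem F v h) ψ hψ hne

end Rational

section CM

variable (K : Type*) [Field K] [NumberField K]
variable (vp : HeightOneSpectrum (𝓞 ℚ)) (v : HeightOneSpectrum (𝓞 (maximalRealSubfield K)))
  [hv : v.asIdeal.LiesOver vp.asIdeal]

include hv in
/-- **CLAUSE (u2) FOR THE RECORD — `F = K⁺`, `K` ANY CM FIELD (stated for every number field `K` with its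
`maximalRealSubfield`), OUTSIDE `disc K`**: at every place `v` of `K⁺` not containing `disc K` (file 322's exceptional
set), for every continuous non-trivial `ψ : ℚ_p → S¹`,
`ψ_v := ψ ∘ Tr_{K⁺_v/ℚ_p}` has the conductor exponent of `ψ`; with the standard `ψ_p` of conductor exponent `0`, `ψ_v`
has conductor `𝒪_v` — the last clause of §N3.10.3's finiteness argument, now in kernel. -/
theorem conductorExp_comp_trace_eq_of_discr_notMem_cm
    (h : ((discr K : ℤ) : 𝓞 (maximalRealSubfield K)) ∉ v.asIdeal)
    (ψ : AddChar (vp.adicCompletion ℚ) Circle) (hψ : Continuous ψ) (hne : ∃ y, ψ y ≠ 1) :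
    conductorExp (ψ.compAddMonoidHom
        (Algebra.trace (vp.adicCompletion ℚ) (v.adicCompletion (maximalRealSubfield K))).toAddMonoidHom)
        Valued.v =
      conductorExp ψ Valued.v :=
  conductorExp_comp_trace_eq_of_ramificationIdx_int_eq_one vp v
    (T5RecordSatakeDiscriminant.ramificationIdx_int_eq_one_plus_of_discr_notMem K v h) ψ hψ hne

include hv in
/-- The same with conductor exponent `0`: if `ψ` is trivial on `ℤ_p` and non-trivial on `p⁻¹ℤ_p` (`n(ψ) = 0`), so is
`ψ ∘ Tr` on `𝒪_v` / `ϖ_v⁻¹ 𝒪_v`. -/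
theorem conductorExp_comp_trace_eq_zero_of_discr_notMem_cm
    (h : ((discr K : ℤ) : 𝓞 (maximalRealSubfield K)) ∉ v.asIdeal)
    (ψ : AddChar (vp.adicCompletion ℚ) Circle) (hψ : Continuous ψ) (hne : ∃ y, ψ y ≠ 1)
    (h0 : conductorExp ψ Valued.v = 0) :
    conductorExp (ψ.compAddMonoidHom
        (Algebra.trace (vp.adicCompletion ℚ) (v.adicCompletion (maximalRealSubfield K))).toAddMonoidHom)
        Valued.v = 0 := by
  rw [conductorExp_comp_trace_eq_of_discr_notMem_cm K vp v h ψ hψ hne, h0]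

end CM

end Summit.Ventures.HodgeRepro2.T5ConductorUnramifiedPlace
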